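import Summits.NavierStokesRegularity.FunctionalMining.TopEigSimpleTop
import HarnessLib

/-!
# FunctionalMining — the Danskin value `μ(A; M)` is upper semicontinuous in `(A, M)`, continuous where
# the top eigenvalue is simple, and NOT continuous at a degenerate top (F1 PART I, Remark (1d))

Search for candidate a priori estimates; no regularity claim. Cell `pub-nsfunc`, prove seat
(gen 23). `μ(A; M) = dirTopEig A M = sup {eᵀMe : e ∈ E(A)}` (`TopEigDanskin.lean`) is the
density of the Danskin formula `T(v) = −∫ qλ₁^{q−1} μ(S; ΔS)` (F1 PART I Thm 1 (c)). Remark (1d) of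
F1 PART I: `μ` is convex and positively homogeneous in `M` (gen 21: `dirTopEig_add_le`,
`dirTopEig_smul_of_nonneg`), UPPER SEMICONTINUOUS in `(A, M)`, continuous at every `(A, M)` with
`λ(A)` simple — and not continuous where a degenerate top eigenvalue splits. Here:

* **`TopEig.eventually_topEigSet_subset`** — upper hemicontinuity of the top eigen-set: if `E(A) ⊆ V`,
  `V` open, then `E(A′) ⊆ V` for `A′` near `A` (compactness of the sphere minus `V`, `1`-Lipschitz
  dependence of `eᵀAe` and `λ(A)` on `A`);
* **`TopEig.dirTopEig_upperSemicontinuous`** — `(A, M) ↦ μ(A; M)` is upper semicontinuous;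
* `TopEig.continuousAt_dirTopEig_of_quad_eq` — continuous at `(A, M)` whenever `eᵀMe` is constant on
  `E(A)`; **`TopEig.continuousAt_dirTopEig_of_gapForm`** — in particular at a simple top (gap form);
* `TopEig.not_continuousAt_dirTopEig_zero` — at `A = 0` (fully degenerate top), `M = diag(1, −1, …)`:
  `μ(0; M) = 1` but `μ(t·e₁⊗e₁…)`-type perturbations give `−1`: concretely `μ(t·P₂; M) = −1` for every
  `t > 0`, `P₂ = e₂ ⊗ e₂`, so `μ(·; M)` is not continuous at `0` (not lower semicontinuous).

What is NOT here: the statement about the functional `T` on fields (that `T` is discontinuous under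
perturbations splitting a degenerate top) — only its pointwise mechanism. [ours; folklore — Danskin 1967
/ Bonnans–Shapiro §4.3 (max-functions are usc in the parameter)]
-/

noncomputable section

open Filter Topology Set Matrix

namespace Summit.NavierStokesRegularity.FunctionalMining

namespace TopEig

variable {d : Type*} [Fintype d] [DecidableEq d] [Nonempty d]

/-! ## 1. Upper hemicontinuity of the top eigen-set -/

omit [DecidableEq d] [Nonempty d] in
/-- `|eᵀA′e − eᵀAe| ≤ ‖A′ − A‖` for a unit vector `e`. [folklore] -/
theorem abs_quad_sub_quad_le (A A' : EuclideanSpace ℝ (d × d)) {e : d → ℝ} (he : e ⬝ᵥ e = 1) :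
    |quad A' e - quad A e| ≤ ‖A' - A‖ := by
  rw [← quad_sub]
  have h := abs_quad_le (A' - A) e
  rw [he, mul_one] at h
  exact h

/-- **UPPER HEMICONTINUITY OF THE TOP EIGEN-SET.** If the top eigen-set `E(A)` lies in an open set `V`,
then `E(A′) ⊆ V` for all `A′` near `A`. (On the compact set `K = sphere ∖ V` the continuous function
`λ(A) − eᵀAe` is positive, hence `≥ δ > 0`; for `‖A′ − A‖ < δ/3` no point of `K` can attain `λ(A′)`.)
[folklore] -/
theorem eventually_topEigSet_subset {A : EuclideanSpace ℝ (d × d)} {V : Set (d → ℝ)} (hV : IsOpen V)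
    (hsub : topEigSet A ⊆ V) : ∀ᶠ A' in 𝓝 A, topEigSet A' ⊆ V := by
  have hKc : IsCompact (unitSphere d ∩ Vᶜ) :=
    SharpClass.DirectorForm.isCompact_unitSphere.inter_right hV.isClosed_compl
  rcases (unitSphere d ∩ Vᶜ).eq_empty_or_nonempty with hKe | hKne
  · refine Eventually.of_forall fun A' e he => ?_
    by_contra hn
    have hmem : e ∈ unitSphere d ∩ Vᶜ := ⟨he.1, hn⟩
    rw [hKe] at hmem
    exact hmem
  · have hcont : ContinuousOn (fun e => lam A - quad A e) (unitSphere d ∩ Vᶜ) :=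
      (continuous_const.sub (continuous_quad A)).continuousOn
    obtain ⟨e₀, he₀K, hmin⟩ := hKc.exists_isMinOn hKne hcont
    have hδ : 0 < lam A - quad A e₀ := by
      have h1 : quad A e₀ ≤ lam A := quad_le_lam A he₀K.1
      have h2 : quad A e₀ ≠ lam A := fun h => he₀K.2 (hsub ⟨he₀K.1, h⟩)
      exact sub_pos.2 (lt_of_le_of_ne h1 h2)
    have hball : ∀ᶠ A' in 𝓝 A, ‖A' - A‖ < (lam A - quad A e₀) / 3 := by
      have h := Metric.ball_mem_nhds A (by positivity : (0 : ℝ) < (lam A - quad A e₀) / 3)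
      filter_upwards [h] with A' hA'
      rwa [Metric.mem_ball, dist_eq_norm] at hA'
    filter_upwards [hball] with A' hA' e he
    by_contra hn
    have heK : e ∈ unitSphere d ∩ Vᶜ := ⟨he.1, hn⟩
    have hmin' : lam A - quad A e₀ ≤ lam A - quad A e := hmin heK
    have h1 := abs_quad_sub_quad_le A A' he.1
    have h2 := abs_lam_sub_lam_le A' A
    have h3 : quad A' e = lam A' := he.2
    rw [abs_le] at h1 h2
    linarith [h1.1, h1.2, h2.1, h2.2]

/-! ## 2. Upper semicontinuity of `μ(A; M)`; continuity at simple tops -/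

/-- **`(A, M) ↦ μ(A; M)` IS UPPER SEMICONTINUOUS** (F1 PART I, Remark (1d)). [folklore — Danskin] -/
theorem dirTopEig_upperSemicontinuous :
    UpperSemicontinuous fun p : EuclideanSpace ℝ (d × d) × EuclideanSpace ℝ (d × d) =>
      dirTopEig p.1 p.2 := by
  rintro ⟨A, M⟩ y hy
  have hy' : dirTopEig A M < y := hy
  set η : ℝ := (y - dirTopEig A M) / 2 with hη
  have hηpos : 0 < η := by rw [hη]; linarith
  -- the open set `V = {eᵀMe < μ + η}` contains `E(A)`
  have hV : IsOpen {e : d → ℝ | quad M e < dirTopEig A M + η} :=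
    isOpen_lt (continuous_quad M) continuous_const
  have hsub : topEigSet A ⊆ {e : d → ℝ | quad M e < dirTopEig A M + η} := fun e he => by
    have h := quad_le_dirTopEig M he
    show quad M e < dirTopEig A M + η
    linarith
  have h1 : ∀ᶠ p : EuclideanSpace ℝ (d × d) × EuclideanSpace ℝ (d × d) in 𝓝 (A, M),
      topEigSet p.1 ⊆ {e : d → ℝ | quad M e < dirTopEig A M + η} :=
    (continuous_fst.tendsto (A, M)).eventually (eventually_topEigSet_subset hV hsub)
  have h2 : ∀ᶠ p : EuclideanSpace ℝ (d × d) × EuclideanSpace ℝ (d × d) in 𝓝 (A, M),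
      ‖p.2 - M‖ < η := by
    have h := (continuous_snd.tendsto (A, M)).eventually (Metric.ball_mem_nhds M hηpos)
    filter_upwards [h] with p hp
    rwa [dist_eq_norm] at hp
  filter_upwards [h1, h2] with p hp1 hp2
  obtain ⟨e, he, heq⟩ := exists_quad_eq_dirTopEig p.1 p.2
  show dirTopEig p.1 p.2 < y
  rw [← heq]
  have hq1 : quad M e < dirTopEig A M + η := hp1 he
  have hq2 := abs_quad_sub_quad_le M p.2 he.1
  rw [abs_le] at hq2
  have : y = dirTopEig A M + 2 * η := by rw [hη]; ring
  linarith [hq2.2]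

/-- **Continuity of `μ` at `(A, M)` when `eᵀMe` is constant on `E(A)`** (e.g. `E(A) = {±c}`): then
`μ` is also lower semicontinuous there. [folklore] -/
theorem continuousAt_dirTopEig_of_quad_eq {A M : EuclideanSpace ℝ (d × d)}
    (hc : ∀ e ∈ topEigSet A, quad M e = dirTopEig A M) :
    ContinuousAt (fun p : EuclideanSpace ℝ (d × d) × EuclideanSpace ℝ (d × d) => dirTopEig p.1 p.2)
      (A, M) := by
  refine Metric.tendsto_nhds.2 fun ε hε => ?_
  have hV : IsOpen {e : d → ℝ | |quad M e - dirTopEig A M| < ε / 2} :=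
    isOpen_lt ((continuous_quad M).sub continuous_const).abs continuous_const
  have hsub : topEigSet A ⊆ {e : d → ℝ | |quad M e - dirTopEig A M| < ε / 2} := fun e he => by
    show |quad M e - dirTopEig A M| < ε / 2
    rw [hc e he, sub_self, abs_zero]
    positivity
  have h1 : ∀ᶠ p : EuclideanSpace ℝ (d × d) × EuclideanSpace ℝ (d × d) in 𝓝 (A, M),
      topEigSet p.1 ⊆ {e : d → ℝ | |quad M e - dirTopEig A M| < ε / 2} :=
    (continuous_fst.tendsto (A, M)).eventually (eventually_topEigSet_subset hV hsub)
  have h2 : ∀ᶠ p : EuclideanSpace ℝ (d × d) × EuclideanSpace ℝ (d × d) in 𝓝 (A, M),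
      ‖p.2 - M‖ < ε / 2 := by
    have h := (continuous_snd.tendsto (A, M)).eventually
      (Metric.ball_mem_nhds M (by positivity : (0 : ℝ) < ε / 2))
    filter_upwards [h] with p hp
    rwa [dist_eq_norm] at hp
  filter_upwards [h1, h2] with p hp1 hp2
  obtain ⟨e, he, heq⟩ := exists_quad_eq_dirTopEig p.1 p.2
  rw [Real.dist_eq]
  show |dirTopEig p.1 p.2 - dirTopEig A M| < ε
  rw [← heq]
  have hq1 : |quad M e - dirTopEig A M| < ε / 2 := hp1 he
  have hq2 := abs_quad_sub_quad_le M p.2 he.1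
  rw [abs_lt] at hq1 ⊢
  rw [abs_le] at hq2
  constructor <;> linarith [hq1.1, hq1.2, hq2.1, hq2.2]

/-- **`μ` IS CONTINUOUS AT EVERY `(A, M)` WITH `λ(A)` SIMPLE** (gap form at a unit top vector `c`:
`eᵀAe ≤ λ₀ − g(1 − (e·c)²)` on the sphere, `g > 0`, `cᵀAc = λ₀`; then `E(A) = {±c}` and
`μ(A; M) = cᵀMc`). F1 PART I, Remark (1d). [folklore — Kato II-§5] -/
theorem continuousAt_dirTopEig_of_gapForm {A : EuclideanSpace ℝ (d × d)} {c : d → ℝ} {lam0 g : ℝ}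
    (hcu : c ∈ unitSphere d) (hg : 0 < g)
    (hgap : ∀ e ∈ unitSphere d, quad A e ≤ lam0 - g * (1 - (e ⬝ᵥ c) ^ 2)) (hAc : quad A c = lam0)
    (M : EuclideanSpace ℝ (d × d)) :
    ContinuousAt (fun p : EuclideanSpace ℝ (d × d) × EuclideanSpace ℝ (d × d) => dirTopEig p.1 p.2)
      (A, M) := by
  refine continuousAt_dirTopEig_of_quad_eq fun e he => ?_
  rw [dirTopEig_eq_quad_of_gapForm hcu hg hgap hAc M]
  rw [topEigSet_eq_pair_of_gapForm hcu hg hgap hAc] at he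
  rcases he with h | h
  · rw [h]
  · rw [h, quad_neg_vec]

/-! ## 3. `μ` is not continuous at a degenerate top -/

/-- At `A = 0` every unit vector is a top vector: `E(0)` is the whole unit sphere and
`μ(0; M) = λ(M)`. [folklore] -/
theorem dirTopEig_zero_left (M : EuclideanSpace ℝ (d × d)) : dirTopEig 0 M = lam M := by
  have hlam0 : lam (0 : EuclideanSpace ℝ (d × d)) = 0 := by
    obtain ⟨e, he, hq⟩ := exists_quad_eq_lam (0 : EuclideanSpace ℝ (d × d))
    rw [← hq]
    simp [quad]
  have hE : topEigSet (0 : EuclideanSpace ℝ (d × d)) = unitSphere d := by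
    ext e
    refine ⟨fun h => h.1, fun h => ⟨h, ?_⟩⟩
    rw [hlam0]
    simp [quad]
  unfold dirTopEig lam
  rw [hE]

/-- **`μ(·; M)` IS NOT CONTINUOUS AT A DEGENERATE TOP** (F1 PART I, Remark (1d), the mechanism behind
'`T` is not continuous under perturbations that split a degenerate top eigenvalue'). Take two indices
`i ≠ j`, `M = eᵢ⊗eᵢ − eⱼ⊗eⱼ` and `A_t = t·eⱼ⊗eⱼ`: `μ(0; M) = 1` while `μ(A_t; M) = −1` for every
`t > 0`, and `A_t → 0`. [folklore] -/
theorem not_continuousAt_dirTopEig_zero {i j : d} (hij : i ≠ j) :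
    ¬ ContinuousAt
      (fun p : EuclideanSpace ℝ (d × d) × EuclideanSpace ℝ (d × d) => dirTopEig p.1 p.2)
      ((0 : EuclideanSpace ℝ (d × d)),
        SharpClass.DirectorForm.flat (Matrix.of fun a b : d =>
          if a = i ∧ b = i then (1 : ℝ) else if a = j ∧ b = j then -1 else 0)) := by
  set M : Matrix d d ℝ := Matrix.of fun a b : d =>
    if a = i ∧ b = i then (1 : ℝ) else if a = j ∧ b = j then -1 else 0 with hM
  set P : Matrix d d ℝ := Matrix.of fun a b : d => if a = j ∧ b = j then (1 : ℝ) else 0 with hP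
  -- quadratic forms of `M` and `P`
  have hMv : ∀ w : d → ℝ, M *ᵥ w = fun a => if a = i then w i else if a = j then -w j else 0 := by
    intro w
    funext a
    simp only [Matrix.mulVec, dotProduct, hM, Matrix.of_apply]
    by_cases hai : a = i
    · subst hai
      simp [hij]
    · by_cases haj : a = j
      · subst haj
        simp [hai]
      · simp [hai, haj]
  have hPv : ∀ w : d → ℝ, P *ᵥ w = fun a => if a = j then w j else 0 := by
    intro w
    funext a
    simp only [Matrix.mulVec, dotProduct, hP, Matrix.of_apply]
    by_cases haj : a = j
    · subst haj; simp
    · simp [haj]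
  have hMq : ∀ w : d → ℝ, w ⬝ᵥ M *ᵥ w = w i ^ 2 - w j ^ 2 := by
    intro w
    rw [hMv]
    simp only [dotProduct]
    rw [Finset.sum_eq_add_of_mem i j (Finset.mem_univ i) (Finset.mem_univ j) hij]
    · simp [Ne.symm hij]; ring
    · intro a _ ha
      simp [ha.1, ha.2]
  have hPq : ∀ w : d → ℝ, w ⬝ᵥ P *ᵥ w = w j ^ 2 := by
    intro w
    rw [hPv]
    simp only [dotProduct]
    rw [Finset.sum_eq_single j]
    · simp; ring
    · intro a _ ha; simp [ha]
    · intro h; exact absurd (Finset.mem_univ j) h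
  have hMsymm : M.IsSymm := by
    ext a b
    simp only [hM, Matrix.transpose_apply, Matrix.of_apply]
    by_cases h1 : a = i <;> by_cases h2 : b = i <;> by_cases h3 : a = j <;> by_cases h4 : b = j <;>
      simp_all
  have hPsymm : P.IsSymm := by
    ext a b
    simp only [hP, Matrix.transpose_apply, Matrix.of_apply]
    by_cases h3 : a = j <;> by_cases h4 : b = j <;> simp_all
  -- `μ(0; M) = λ(M) = 1` (gap form for `M` at `eᵢ` with `λ₀ = 1`, `g = 1`)
  have hei : (Pi.single i (1 : ℝ) : d → ℝ) ∈ unitSphere d := single_mem_unitSphere i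
  have hMe : M *ᵥ (Pi.single i (1 : ℝ)) = (1 : ℝ) • Pi.single i (1 : ℝ) := by
    rw [hMv, one_smul]
    funext a
    by_cases hai : a = i
    · subst hai; simp
    · by_cases haj : a = j
      · subst haj; simp [hai]
      · simp [hai, haj]
  have hMgap : ∀ w : d → ℝ, w ⬝ᵥ Pi.single i (1 : ℝ) = 0 → w ⬝ᵥ M *ᵥ w ≤ (1 - 1) * (w ⬝ᵥ w) := by
    intro w hw
    have hwi : w i = 0 := by simpa using hw
    rw [hMq, hwi]
    nlinarith [sq_nonneg (w j)]
  have hMgf := gapForm_of_eigenvector hMsymm hei hMe hMgap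
  have hMquad : quad (SharpClass.DirectorForm.flat M) (Pi.single i (1 : ℝ)) = 1 := by
    rw [SharpClass.DirectorForm.quad_flat, hMq]
    simp [Ne.symm hij]
  have hμ0 : dirTopEig 0 (SharpClass.DirectorForm.flat M) = 1 := by
    rw [dirTopEig_zero_left]
    exact lam_eq_of_gapForm hei (by norm_num) hMgf hMquad
  -- `μ(t P; M) = −1` for `t > 0` (gap form for `tP` at `eⱼ` with `λ₀ = t`, `g = t`)
  have hej : (Pi.single j (1 : ℝ) : d → ℝ) ∈ unitSphere d := single_mem_unitSphere j
  have hμt : ∀ t : ℝ, 0 < t →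
      dirTopEig (t • SharpClass.DirectorForm.flat P) (SharpClass.DirectorForm.flat M) = -1 := by
    intro t ht
    have hflat : t • SharpClass.DirectorForm.flat P = SharpClass.DirectorForm.flat (t • P) := by
      ext p
      simp [SharpClass.DirectorForm.flat]
    have htPsymm : (t • P).IsSymm := hPsymm.smul t
    have hPe : (t • P) *ᵥ (Pi.single j (1 : ℝ)) = t • Pi.single j (1 : ℝ) := by
      rw [Matrix.smul_mulVec, hPv]
      congr 1
      funext a
      by_cases haj : a = j
      · subst haj; simp
      · simp [haj]
    have hPgap : ∀ w : d → ℝ, w ⬝ᵥ Pi.single j (1 : ℝ) = 0 →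
        w ⬝ᵥ (t • P) *ᵥ w ≤ (t - t) * (w ⬝ᵥ w) := by
      intro w hw
      have hwj : w j = 0 := by simpa using hw
      rw [Matrix.smul_mulVec, dotProduct_smul, hPq, hwj, smul_eq_mul]
      simp
    have hPgf := gapForm_of_eigenvector htPsymm hej hPe hPgap
    have hPquad : quad (SharpClass.DirectorForm.flat (t • P)) (Pi.single j (1 : ℝ)) = t := by
      rw [SharpClass.DirectorForm.quad_flat, Matrix.smul_mulVec, dotProduct_smul, hPq, smul_eq_mul]
      simp
    rw [hflat, dirTopEig_eq_quad_of_gapForm hej ht hPgf hPquad, SharpClass.DirectorForm.quad_flat, hMq]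
    simp [hij]
  -- along `t ↓ 0` the values are `−1`, the value at `t = 0` is `1`
  intro hcont
  have hcurve : Tendsto (fun t : ℝ => (t • SharpClass.DirectorForm.flat P, SharpClass.DirectorForm.flat M))
      (𝓝[>] 0) (𝓝 ((0 : EuclideanSpace ℝ (d × d)), SharpClass.DirectorForm.flat M)) := by
    have h1 : Tendsto (fun t : ℝ => t • SharpClass.DirectorForm.flat P) (𝓝 0) (𝓝 0) := by
      have hc : Continuous fun t : ℝ => t • SharpClass.DirectorForm.flat P :=
        continuous_id.smul continuous_const
      simpa using hc.tendsto 0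
    exact (h1.mono_left nhdsWithin_le_nhds).prodMk_nhds tendsto_const_nhds
  have hlim := hcont.tendsto.comp hcurve
  rw [hμ0] at hlim
  have hconst : (fun t : ℝ => dirTopEig (t • SharpClass.DirectorForm.flat P) (SharpClass.DirectorForm.flat M))
      =ᶠ[𝓝[>] (0 : ℝ)] fun _ => (-1 : ℝ) := by
    filter_upwards [self_mem_nhdsWithin] with t ht
    exact hμt t ht
  have hlim' : Tendsto (fun _ : ℝ => (-1 : ℝ)) (𝓝[>] (0 : ℝ)) (𝓝 (1 : ℝ)) := hlim.congr' hconst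
  have h := tendsto_nhds_unique hlim' tendsto_const_nhds
  norm_num at h

end TopEig

end Summit.NavierStokesRegularity.FunctionalMining

end
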